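import Summits.ResolutionOfSingularities.ResolutionOfSingularities.Theorems.WildQuotientsSummitReductionStubPairRegularBaseChangeGaloisLink
import HarnessLib

/-!
# `WildQuotients.SummitReduction` (stmt-ResolutionOfSingularities-16324), line `FramePerfect`:
# stub `stub_pair_regularBaseChange` reduced to the stability of quasi-splitness under base change

Route `ResolutionOfSingularities/WildQuotients`, crux `SummitReduction`; fourth helper file of stub
`stub_pair_regularBaseChange` (de Jong 1997, 5.4 + "(5.12.1) for the base" in the proof of
Thm. 5.13) of the line skeleton `Cruxes/SummitReduction/Lines/FramePerfect.lean` (v6). The single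
theorem `stub_pair_regularBaseChange_of_quasiSplitBaseChange` has the registered signature of the
stub followed by ONE hypothesis `hQS`, a general fact of base-change bookkeeping not yet in the
tree — **quasi-splitness is stable under base change**: for a semi-stable curve `f : X → Y` whose
non-smooth points `x` have completed fibre local ring `κ(f x)⟦u,v⟧/(uv)` compatibly with `κ(f x)`,
the same holds for `X ×_Y Y' → Y'` (de Jong 1997, 5.7 ff.; a point of `X ×_Y Y'` where `pr₂` is not
smooth lies over a non-smooth `x`, which is `κ(y)`-rational, so there is exactly one point over
`(x, y')` and its completed fibre local ring is `(κ(y)⟦u,v⟧/(uv) ⊗_{κ(y)} κ(y'))^`). Everything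
else — the construction of the `G'`-semi-stable pair over the regular base `Y₂` and of its Galois
link to `(X, G, Z)` — is PROVED, from the three sibling helper files (`…RegularBaseChangeLemmas`,
`…RegularBaseChangePullback`, `…RegularBaseChangeGaloisLink`) and, here,
`functionFieldMap_fieldRange_sup_eq_top`: **the function field of an integral fibre product
`X ×_Y Y'` with dominant projections is the compositum of `K(X)` and `K(Y')`** (proved through the
bijection `SpecToEquivOfLocalRing`: the canonical `Spec K(P) → P` factors through `Spec` of the
compositum).
-/

set_option linter.dupNamespace false

noncomputable section

open CategoryTheory CategoryTheory.Limits AlgebraicGeometry TopologicalSpace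
open Literature.AlgebraicGeometry.Resolution
open Literature.AlgebraicGeometry.Motives (RatFn.functionFieldMap RatFn.functionFieldMap_comp)
open Literature.AlgebraicGeometry

namespace Summit.ResolutionOfSingularities.ResolutionOfSingularities.Theorems

universe u

/-! ## The function field of a fibre product -/

/-- **`Spec K(X') → X' → X` through the function field map**: for a dominant `γ : X' → X` of
integral schemes, `(Spec K(X') → X') ≫ γ = Spec(γ♯) ≫ (Spec K(X) → X)`. [folklore] -/
theorem fromSpecStalk_genericPoint_comp {X' X : Scheme.{u}} [IsIntegral X'] [IsIntegral X]
    (γ : X' ⟶ X) [IsDominant γ] :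
    X'.fromSpecStalk (genericPoint X') ≫ γ =
      Spec.map (CommRingCat.ofHom (RatFn.functionFieldMap γ)) ≫ X.fromSpecStalk (genericPoint X) := by
  rw [← Scheme.SpecMap_stalkMap_fromSpecStalk,
    ← Scheme.SpecMap_stalkSpecializes_fromSpecStalk (Motives.RatFn.specializes_genericPoint γ),
    ← Category.assoc, ← Spec.map_comp]
  rfl

/-- **The function field of an integral fibre product is the compositum of the function fields of
the factors**: for `f : X → Y`, `ψ : Y' → Y` dominant morphisms of integral schemes with
`P = X ×_Y Y'` integral and both projections dominant, `K(P)` is generated (as a field) by the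
images of `K(X)` and `K(Y')`. Proof: let `F ⊆ K(P)` be the subfield they generate. The maps
`K(X) → F ← K(Y')` agree on `K(Y)`, so `Spec F → Spec K(X) → X` and `Spec F → Spec K(Y') → Y'`
define `j : Spec F → P`, and the canonical `ι : Spec K(P) → P` factors as
`Spec K(P) → Spec F → P` (check on the projections). Writing `j = Spec(φ) ≫ (Spec 𝒪_{P,x} → P)`
with `φ : 𝒪_{P,x} → F` local (`Scheme.Spec_stalkClosedPointTo_fromSpecStalk`), the bijection
`SpecToEquivOfLocalRing` compares the two factorisations of `ι` and shows that
`𝒪_{P,ξ} → F ⊆ K(P)` is an isomorphism, so `F = K(P)`. (For affine pieces: `K(P) = Frac(A ⊗_C B)`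
is generated by `A` and `B`.) [folklore] -/
theorem functionFieldMap_fieldRange_sup_eq_top {X Y Y' : Scheme.{u}} [IsIntegral X]
    [IsIntegral Y] [IsIntegral Y'] (f : X ⟶ Y) (ψ : Y' ⟶ Y) [IsDominant f] [IsDominant ψ]
    [IsIntegral (pullback f ψ)] [IsDominant (pullback.fst f ψ)] [IsDominant (pullback.snd f ψ)] :
    (RatFn.functionFieldMap (pullback.fst f ψ)).fieldRange ⊔
      (RatFn.functionFieldMap (pullback.snd f ψ)).fieldRange = ⊤ := by
  set P := pullback f ψ with hP
  set F : Subfield P.functionField := (RatFn.functionFieldMap (pullback.fst f ψ)).fieldRange ⊔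
      (RatFn.functionFieldMap (pullback.snd f ψ)).fieldRange with hFdef
  -- the maps `K(X) → F ← K(Y')`
  let aF : X.functionField →+* F := (RatFn.functionFieldMap (pullback.fst f ψ)).codRestrict F
    fun x => (le_sup_left : _ ≤ F) (RingHom.mem_fieldRange_self _ x)
  let bF : Y'.functionField →+* F := (RatFn.functionFieldMap (pullback.snd f ψ)).codRestrict F
    fun x => (le_sup_right : _ ≤ F) (RingHom.mem_fieldRange_self _ x)
  have haF : F.subtype.comp aF = RatFn.functionFieldMap (pullback.fst f ψ) := RingHom.ext fun _ => rfl
  have hbF : F.subtype.comp bF = RatFn.functionFieldMap (pullback.snd f ψ) := RingHom.ext fun _ => rfl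
  have hab : aF.comp (RatFn.functionFieldMap f) = bF.comp (RatFn.functionFieldMap ψ) := by
    refine RingHom.ext fun c => Subtype.ext ?_
    show RatFn.functionFieldMap (pullback.fst f ψ) (RatFn.functionFieldMap f c) =
      RatFn.functionFieldMap (pullback.snd f ψ) (RatFn.functionFieldMap ψ c)
    rw [← RingHom.comp_apply, ← RatFn.functionFieldMap_comp, ← RingHom.comp_apply,
      ← RatFn.functionFieldMap_comp]
    congr 1
    exact ratFn_functionFieldMap_congr pullback.condition
  -- `j : Spec F → P`
  let α : Spec (.of F) ⟶ X := Spec.map (CommRingCat.ofHom aF) ≫ X.fromSpecStalk (genericPoint X)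
  let β : Spec (.of F) ⟶ Y' := Spec.map (CommRingCat.ofHom bF) ≫ Y'.fromSpecStalk (genericPoint Y')
  have hαβ : α ≫ f = β ≫ ψ := by
    simp only [α, β, Category.assoc, fromSpecStalk_genericPoint_comp, ← Spec.map_comp_assoc]
    congr 2
    change CommRingCat.ofHom (aF.comp (RatFn.functionFieldMap f)) =
      CommRingCat.ofHom (bF.comp (RatFn.functionFieldMap ψ))
    rw [hab]
  let j : Spec (.of F) ⟶ P := pullback.lift α β hαβ
  -- `ι : Spec K(P) → P` factors through `j`
  let s : Spec P.functionField ⟶ Spec (.of F) := Spec.map (CommRingCat.ofHom F.subtype)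
  have hι : s ≫ j = P.fromSpecStalk (genericPoint P) := by
    apply pullback.hom_ext
    · rw [Category.assoc, pullback.lift_fst, fromSpecStalk_genericPoint_comp]
      simp only [α, s, ← Spec.map_comp_assoc]
      congr 2
    · rw [Category.assoc, pullback.lift_snd, fromSpecStalk_genericPoint_comp]
      simp only [β, s, ← Spec.map_comp_assoc]
      congr 2
  -- compare the two descriptions of `ι` through `SpecToEquivOfLocalRing`
  haveI : IsLocalHom F.subtype := ⟨fun a ha => isUnit_iff_ne_zero.mpr fun h => by
    rw [h, map_zero] at ha; exact not_isUnit_zero ha⟩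
  haveI : IsLocalHom (CommRingCat.ofHom F.subtype).hom := by
    rw [CommRingCat.hom_ofHom]; infer_instance
  let φ := Scheme.stalkClosedPointTo j
  have hj : Spec.map φ ≫ P.fromSpecStalk _ = j := Scheme.Spec_stalkClosedPointTo_fromSpecStalk j
  haveI : IsLocalHom (φ ≫ CommRingCat.ofHom F.subtype).hom := by
    rw [CommRingCat.hom_comp]; infer_instance
  let e := SpecToEquivOfLocalRing P P.functionField
  have hA : e.symm ⟨genericPoint P, 𝟙 _, inferInstance⟩ = P.fromSpecStalk (genericPoint P) := by
    rw [SpecToEquivOfLocalRing_symm_apply, Spec.map_id, Category.id_comp]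
  have hB : e.symm ⟨_, φ ≫ CommRingCat.ofHom F.subtype, inferInstance⟩ =
      P.fromSpecStalk (genericPoint P) := by
    rw [SpecToEquivOfLocalRing_symm_apply]
    show Spec.map (φ ≫ CommRingCat.ofHom F.subtype) ≫ P.fromSpecStalk _ = _
    rw [Spec.map_comp, Category.assoc, hj]
    exact hι
  have hAB := e.symm.injective (hB.trans hA.symm)
  -- so `𝒪_{P,ξ} → F ⊆ K(P)` is an isomorphism: `F = K(P)`
  have hiso : IsIso (φ ≫ CommRingCat.ofHom F.subtype) := by
    obtain ⟨h₁, h₂⟩ := SpecToEquivOfLocalRing_eq_iff.mp hAB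
    change φ ≫ CommRingCat.ofHom F.subtype = _ at h₂
    rw [h₂]
    dsimp only
    infer_instance
  have hsurj : Function.Surjective F.subtype := by
    have h3 : Function.Surjective (φ ≫ CommRingCat.ofHom F.subtype).hom :=
      (asIso (φ ≫ CommRingCat.ofHom F.subtype)).commRingCatIsoToRingEquiv.surjective
    rw [CommRingCat.hom_comp, CommRingCat.hom_ofHom] at h3
    exact Function.Surjective.of_comp h3
  rw [eq_top_iff]
  intro y _
  obtain ⟨x, rfl⟩ := hsurj y
  exact x.2

/-! ## The reduction -/

/-- **The pull-back step of the pair induction, reduced to two pieces of base-change bookkeeping**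
(de Jong 1997, 5.4 with (5.4.1), as used in the proof of Thm. 5.13: "Next, by (5.12.1) for `S`, we
may assume that `S` is regular and that `Z₀ ⊂ S` is a `G`-strict normal crossings divisor"). The
statement is that of the registered stub `stub_pair_regularBaseChange` — a `G₁`-semi-stable
quasi-split curve `f₁ : X₁ → Y₁` with sections, its Galois link to `(X, G, Z)`, and de Jong's
conclusion `hbase` for the base pair `(Y₁, G₁, D₁)` (a regular projective `Y₂` with a
`φ₂`-equivariant alteration `ψ₂ : Y₂ → Y₁`, `K(Y₁)^{G₁} ⊂ K(Y₂)^{G₂}` purely inseparable, and a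
`G₂`-stable `G₂`-strict strict normal crossings divisor `D₂ ⊇ ψ₂⁻¹ D₁`) yield a semi-stable pair
over the regular base with its Galois link — with ONE general fact taken as hypothesis: `hQS`,
quasi-splitness of semi-stable curves is stable under base change (de Jong 1997, 5.7 ff.: the
singular points of the fibres stay rational with rational branches, the completed local ring of
the fibre of `X ×_Y Y' → Y'` at a point over a non-smooth `x` being
`(𝒪̂_{X_y,x} ⊗_{κ(y)} κ(y'))^ ≅ κ(y')⟦u,v⟧/(uv)`). Construction: `X' = X₁ ×_{Y₁} Y₂`
(integral: `isIntegral_pullback_of_isSemiStableCurve`, the generic point of `Y₁` being off `D₁` as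
`ψ₂⁻¹ D₁` lies in a strict normal crossings divisor), `f' = pr₂`, `q' = ψ₂ ≫ q₁`, the pulled-back
sections, `D' = D₂`, the group `G' = {(g₂, g₁) | ρ₂ g₂ ≫ ψ₂ = ψ₂ ≫ ρ_{Y₁} g₁} ⊆ G₂ × G₁` acting on
`X'` by `pullback.map` and on `Y₂` through `G₂`, `φ' = φ₁ ∘ pr₂`, `π' = pr₁ ≫ π₁`. Then: `X'` is
projective (`Y₁` is separated under the proper surjective `f₁` from the projective `X₁`; Segre),
`f'` is semi-stable (base change), smooth outside `D₂ ⊇ ψ₂⁻¹ D₁`, with disjoint sections into the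
smooth locus permuted by `G'` (checked on the projections), `pr₁` is an alteration (base change of
`ψ₂`, `f₁` surjective), `pr₂ : G' → G₁` is onto (`G'` contains the graph of `φ₂`), every `g₂`
acting on `Y₂` over `Y₁` gives `(g₂, 1) ∈ G'` — condition (5.4.1) — so `galois_clause_pullback`
(with `functionFieldMap_fieldRange_sup_eq_top`: `K(X')` is the compositum of `K(X₁)` and `K(Y₂)`)
gives the purely inseparable clause, and the boundary pulls back into the boundary.
[cite: DeJong1997, 5.4 and proof of Thm. 5.13, pp. 613, 620] -/
theorem stub_pair_regularBaseChange_of_quasiSplitBaseChange (k : Type) [Field k]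
    (X : Scheme.{0}) [IsIntegral X] (f : X ⟶ Spec (.of k))
    (G : Type) [Group G] [Finite G] (ρ : G →* Aut X) (Z : Set X)
    (G₁ : Type) [Group G₁] [Finite G₁] (X₁ Y₁ : Scheme.{0}) [IsIntegral X₁] [IsIntegral Y₁]
    (f₁ : X₁ ⟶ Y₁) (q₁ : Y₁ ⟶ Spec (.of k)) (ρX₁ : G₁ →* Aut X₁) (ρY₁ : G₁ →* Aut Y₁)
    (D₁ : Set Y₁) (hD₁ : IsClosed D₁) (m : ℕ) (σ : Fin m → (Y₁ ⟶ X₁))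
    (hprojX₁ : Motives.IsProjectiveOver (Over.mk (f₁ ≫ q₁)))
    (hss₁ : IsSemiStableCurve f₁)
    (hqs₁ : (∀ x : X₁, (¬ ∃ U : X₁.Opens, x ∈ U ∧ Smooth (U.ι ≫ f₁)) →
        ∃ e : AdicCompletion
            ((IsLocalRing.maximalIdeal (X₁.presheaf.stalk x)).map (Ideal.Quotient.mk
              ((IsLocalRing.maximalIdeal (Y₁.presheaf.stalk (f₁.base x))).map (f₁.stalkMap x).hom)))
            (X₁.presheaf.stalk x ⧸
              (IsLocalRing.maximalIdeal (Y₁.presheaf.stalk (f₁.base x))).map (f₁.stalkMap x).hom) ≃+*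
          MvPowerSeries (Fin 2) (Y₁.presheaf.stalk (f₁.base x) ⧸ IsLocalRing.maximalIdeal (Y₁.presheaf.stalk (f₁.base x))) ⧸
            Ideal.span {(MvPowerSeries.X 0 * MvPowerSeries.X 1 :
              MvPowerSeries (Fin 2) (Y₁.presheaf.stalk (f₁.base x) ⧸ IsLocalRing.maximalIdeal (Y₁.presheaf.stalk (f₁.base x))))},
          e.toRingHom.comp ((algebraMap (X₁.presheaf.stalk x ⧸
              (IsLocalRing.maximalIdeal (Y₁.presheaf.stalk (f₁.base x))).map (f₁.stalkMap x).hom) _).comp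
            (Ideal.quotientMap ((IsLocalRing.maximalIdeal (Y₁.presheaf.stalk (f₁.base x))).map (f₁.stalkMap x).hom)
              (f₁.stalkMap x).hom Ideal.le_comap_map)) =
          algebraMap (Y₁.presheaf.stalk (f₁.base x) ⧸ IsLocalRing.maximalIdeal (Y₁.presheaf.stalk (f₁.base x))) _))
    (hsm₁ : Smooth (f₁ ∣_ ⟨D₁ᶜ, hD₁.isOpen_compl⟩))
    (_hgi₁ : GeometricallyIrreducible (f₁.fiberToSpecResidueField (genericPoint Y₁)))
    (hσf : (∀ i : Fin m, σ i ≫ f₁ = 𝟙 Y₁))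
    (hσdisj : (Pairwise fun i j : Fin m => Disjoint (Set.range (σ i)) (Set.range (σ j))))
    (hσsm : (∀ i : Fin m, ∃ U : X₁.Opens, Set.range (σ i) ⊆ (U : Set X₁) ∧ Smooth (U.ι ≫ f₁)))
    (hf₁G : (∀ g : G₁, (ρX₁ g).hom ≫ f₁ = f₁ ≫ (ρY₁ g).hom))
    (hσG : (∀ (g : G₁) (i : Fin m), ∃ j : Fin m, σ i ≫ (ρX₁ g).hom = (ρY₁ g).hom ≫ σ j))
    (φ₁ : G₁ →* G) (π₁ : X₁ ⟶ X) [IsDominant π₁]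
    (hφsurj : Function.Surjective φ₁)
    (hπalt : IsAlteration π₁)
    (hπcomm : f₁ ≫ q₁ = π₁ ≫ f)
    (hπG : (∀ g : G₁, (ρX₁ g).hom ≫ π₁ = π₁ ≫ (ρ (φ₁ g)).hom))
    (hgal : (∀ a : X₁.functionField, (∀ g : G₁, RatFn.functionFieldMap (ρX₁ g).hom a = a) →
        ∃ (n : ℕ) (c : X.functionField), (∀ g : G, RatFn.functionFieldMap (ρ g).hom c = c) ∧
          a ^ ringExpChar X.functionField ^ n = RatFn.functionFieldMap π₁ c))
    (hZbd : π₁.base ⁻¹' Z ⊆ DeJong1996.semiStableBoundary f₁ D₁ σ)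
    (hbase : ∃ (G₂ : Type) (_ : Group G₂) (_ : Finite G₂) (X₂ : Scheme.{0}) (_ : IsIntegral X₂)
        (ρ₂ : G₂ →* Aut X₂) (φ₂ : G₂ →* G₁) (π₂ : X₂ ⟶ Y₁) (_ : IsDominant π₂),
        Function.Surjective φ₂ ∧ IsAlteration π₂ ∧ Scheme.IsRegular X₂ ∧
        Motives.IsProjectiveOver (Over.mk (π₂ ≫ q₁)) ∧
        (∀ g : G₂, (ρ₂ g).hom ≫ π₂ = π₂ ≫ (ρY₁ (φ₂ g)).hom) ∧
        (∀ a : X₂.functionField, (∀ g : G₂, RatFn.functionFieldMap (ρ₂ g).hom a = a) →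
          ∃ (n : ℕ) (c : Y₁.functionField), (∀ g : G₁, RatFn.functionFieldMap (ρY₁ g).hom c = c) ∧
            a ^ ringExpChar Y₁.functionField ^ n = RatFn.functionFieldMap π₂ c) ∧
        ∃ D₂ : Set X₂, IsStrictNormalCrossingsDivisor X₂ D₂ ∧ π₂.base ⁻¹' (D₁) ⊆ D₂ ∧
          (∀ g : G₂, (ρ₂ g).hom.base '' D₂ = D₂) ∧
          (∀ (g : G₂) (C : Set X₂), Maximal (fun C : Set X₂ => IsIrreducible C ∧ C ⊆ D₂) C →
            (C ∩ (ρ₂ g).hom.base '' C).Nonempty → (ρ₂ g).hom.base '' C = C))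
    (hQS : ∀ {X Y Y' : Scheme.{0}} [IsIntegral X] [IsIntegral Y] [IsIntegral Y']
      [IsLocallyNoetherian X] [IsLocallyNoetherian Y'] (f : X ⟶ Y) (ψ : Y' ⟶ Y)
      [IsIntegral (pullback f ψ)], IsSemiStableCurve f →
      (∀ x : X, (¬ ∃ U : X.Opens, x ∈ U ∧ Smooth (U.ι ≫ f)) →
        ∃ e : AdicCompletion
            ((IsLocalRing.maximalIdeal (X.presheaf.stalk x)).map (Ideal.Quotient.mk
              ((IsLocalRing.maximalIdeal (Y.presheaf.stalk (f.base x))).map (f.stalkMap x).hom)))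
            (X.presheaf.stalk x ⧸
              (IsLocalRing.maximalIdeal (Y.presheaf.stalk (f.base x))).map (f.stalkMap x).hom) ≃+*
          MvPowerSeries (Fin 2) (Y.presheaf.stalk (f.base x) ⧸ IsLocalRing.maximalIdeal (Y.presheaf.stalk (f.base x))) ⧸
            Ideal.span {(MvPowerSeries.X 0 * MvPowerSeries.X 1 :
              MvPowerSeries (Fin 2) (Y.presheaf.stalk (f.base x) ⧸ IsLocalRing.maximalIdeal (Y.presheaf.stalk (f.base x))))},
          e.toRingHom.comp ((algebraMap (X.presheaf.stalk x ⧸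
              (IsLocalRing.maximalIdeal (Y.presheaf.stalk (f.base x))).map (f.stalkMap x).hom) _).comp
            (Ideal.quotientMap ((IsLocalRing.maximalIdeal (Y.presheaf.stalk (f.base x))).map (f.stalkMap x).hom)
              (f.stalkMap x).hom Ideal.le_comap_map)) =
          algebraMap (Y.presheaf.stalk (f.base x) ⧸ IsLocalRing.maximalIdeal (Y.presheaf.stalk (f.base x))) _) →
      (∀ x : ↥(pullback f ψ), (¬ ∃ U : (pullback f ψ).Opens, x ∈ U ∧ Smooth (U.ι ≫ (pullback.snd f ψ))) →
        ∃ e : AdicCompletion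
            ((IsLocalRing.maximalIdeal ((pullback f ψ).presheaf.stalk x)).map (Ideal.Quotient.mk
              ((IsLocalRing.maximalIdeal (Y'.presheaf.stalk ((pullback.snd f ψ).base x))).map ((pullback.snd f ψ).stalkMap x).hom)))
            ((pullback f ψ).presheaf.stalk x ⧸
              (IsLocalRing.maximalIdeal (Y'.presheaf.stalk ((pullback.snd f ψ).base x))).map ((pullback.snd f ψ).stalkMap x).hom) ≃+*
          MvPowerSeries (Fin 2) (Y'.presheaf.stalk ((pullback.snd f ψ).base x) ⧸ IsLocalRing.maximalIdeal (Y'.presheaf.stalk ((pullback.snd f ψ).base x))) ⧸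
            Ideal.span {(MvPowerSeries.X 0 * MvPowerSeries.X 1 :
              MvPowerSeries (Fin 2) (Y'.presheaf.stalk ((pullback.snd f ψ).base x) ⧸ IsLocalRing.maximalIdeal (Y'.presheaf.stalk ((pullback.snd f ψ).base x))))},
          e.toRingHom.comp ((algebraMap ((pullback f ψ).presheaf.stalk x ⧸
              (IsLocalRing.maximalIdeal (Y'.presheaf.stalk ((pullback.snd f ψ).base x))).map ((pullback.snd f ψ).stalkMap x).hom) _).comp
            (Ideal.quotientMap ((IsLocalRing.maximalIdeal (Y'.presheaf.stalk ((pullback.snd f ψ).base x))).map ((pullback.snd f ψ).stalkMap x).hom)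
              ((pullback.snd f ψ).stalkMap x).hom Ideal.le_comap_map)) =
          algebraMap (Y'.presheaf.stalk ((pullback.snd f ψ).base x) ⧸ IsLocalRing.maximalIdeal (Y'.presheaf.stalk ((pullback.snd f ψ).base x))) _)) :
    ∃ (G' : Type) (_ : Group G') (_ : Finite G') (X' Y' : Scheme.{0}) (_ : IsIntegral X')
      (_ : IsIntegral Y') (f' : X' ⟶ Y') (q' : Y' ⟶ Spec (.of k)) (ρX' : G' →* Aut X')
      (ρY' : G' →* Aut Y') (D' : Set Y') (hD' : IsStrictNormalCrossingsDivisor Y' D') (m : ℕ)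
      (τ : Fin m → (Y' ⟶ X')),
      Motives.IsProjectiveOver (Over.mk (f' ≫ q')) ∧
      Scheme.IsRegular Y' ∧
      (∀ g : G', (ρY' g).hom.base '' D' = D') ∧
      (∀ (g : G') (C : Set Y'), Maximal (fun C : Set Y' => IsIrreducible C ∧ C ⊆ D') C →
        (C ∩ (ρY' g).hom.base '' C).Nonempty → (ρY' g).hom.base '' C = C) ∧
      IsSemiStableCurve f' ∧
      (∀ x : X', (¬ ∃ U : X'.Opens, x ∈ U ∧ Smooth (U.ι ≫ f')) →
        ∃ e : AdicCompletion
            ((IsLocalRing.maximalIdeal (X'.presheaf.stalk x)).map (Ideal.Quotient.mk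
              ((IsLocalRing.maximalIdeal (Y'.presheaf.stalk (f'.base x))).map (f'.stalkMap x).hom)))
            (X'.presheaf.stalk x ⧸
              (IsLocalRing.maximalIdeal (Y'.presheaf.stalk (f'.base x))).map (f'.stalkMap x).hom) ≃+*
          MvPowerSeries (Fin 2) (Y'.presheaf.stalk (f'.base x) ⧸ IsLocalRing.maximalIdeal (Y'.presheaf.stalk (f'.base x))) ⧸
            Ideal.span {(MvPowerSeries.X 0 * MvPowerSeries.X 1 :
              MvPowerSeries (Fin 2) (Y'.presheaf.stalk (f'.base x) ⧸ IsLocalRing.maximalIdeal (Y'.presheaf.stalk (f'.base x))))},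
          e.toRingHom.comp ((algebraMap (X'.presheaf.stalk x ⧸
              (IsLocalRing.maximalIdeal (Y'.presheaf.stalk (f'.base x))).map (f'.stalkMap x).hom) _).comp
            (Ideal.quotientMap ((IsLocalRing.maximalIdeal (Y'.presheaf.stalk (f'.base x))).map (f'.stalkMap x).hom)
              (f'.stalkMap x).hom Ideal.le_comap_map)) =
          algebraMap (Y'.presheaf.stalk (f'.base x) ⧸ IsLocalRing.maximalIdeal (Y'.presheaf.stalk (f'.base x))) _) ∧
      Smooth (f' ∣_ ⟨D'ᶜ, hD'.isClosed.isOpen_compl⟩) ∧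
      (∀ i : Fin m, τ i ≫ f' = 𝟙 Y') ∧
      (Pairwise fun i j : Fin m => Disjoint (Set.range (τ i)) (Set.range (τ j))) ∧
      (∀ i : Fin m, ∃ U : X'.Opens, Set.range (τ i) ⊆ (U : Set X') ∧ Smooth (U.ι ≫ f')) ∧
      (∀ g : G', (ρX' g).hom ≫ f' = f' ≫ (ρY' g).hom) ∧
      (∀ (g : G') (i : Fin m), ∃ j : Fin m, τ i ≫ (ρX' g).hom = (ρY' g).hom ≫ τ j) ∧
      ∃ (φ' : G' →* G) (π' : X' ⟶ X) (_ : IsDominant π'),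
        Function.Surjective φ' ∧ IsAlteration π' ∧ f' ≫ q' = π' ≫ f ∧
        (∀ g : G', (ρX' g).hom ≫ π' = π' ≫ (ρ (φ' g)).hom) ∧
        (∀ a : X'.functionField, (∀ g : G', RatFn.functionFieldMap (ρX' g).hom a = a) →
          ∃ (n : ℕ) (c : X.functionField), (∀ g : G, RatFn.functionFieldMap (ρ g).hom c = c) ∧
            a ^ ringExpChar X.functionField ^ n = RatFn.functionFieldMap π' c) ∧
        π'.base ⁻¹' Z ⊆ DeJong1996.semiStableBoundary f' D' τ := by
  obtain ⟨G₂, _, _, Y₂, _, ρ₂, φ₂, ψ₂, _, hφ₂, hψ₂alt, hreg₂, hproj₂, hψ₂G, hgal₂, D₂, hD₂, hD₁D₂,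
    hD₂stab, hD₂strict⟩ := hbase
  -- standing instances
  haveI := hss₁.flat
  haveI := hss₁.isProper
  haveI : Surjective f₁ := semiStableCurve_surjective hss₁
  haveI := hψ₂alt.isProper
  haveI : Surjective ψ₂ := hψ₂alt.surjective
  have hη : genericPoint Y₁ ∉ D₁ := genericPoint_notMem_of_preimage_subset_sncd ψ₂ hD₂ hD₁D₂
  haveI : IsIntegral (pullback f₁ ψ₂) :=
    isIntegral_pullback_of_isSemiStableCurve hss₁ hD₁ hsm₁ hη ψ₂
  haveI : IsProper (f₁ ≫ q₁) := Motives.IsProjectiveOver.isProper (X := Over.mk (f₁ ≫ q₁)) hprojX₁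
  haveI : IsSeparated (f₁ ≫ q₁) := inferInstance
  haveI : X₁.IsSeparated := (HasAffineProperty.iff_of_isAffine (P := @IsSeparated)).mp ‹_›
  haveI : Y₁.IsSeparated := isSeparated_base_of_isSemiStableCurve hss₁
  haveI : IsProper (ψ₂ ≫ q₁) := Motives.IsProjectiveOver.isProper (X := Over.mk (ψ₂ ≫ q₁)) hproj₂
  haveI : IsLocallyNoetherian X₁ := LocallyOfFiniteType.isLocallyNoetherian (f₁ ≫ q₁)
  haveI : IsLocallyNoetherian Y₂ := LocallyOfFiniteType.isLocallyNoetherian (ψ₂ ≫ q₁)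
  -- the group `G' = {(g₂, g₁) | ρ₂ g₂ covers ρY₁ g₁ along ψ₂}` (it contains the graph of `φ₂` and,
  -- by the rigidity of `ψ₂`, every `(g₂, 1)` with `g₂` acting trivially on `K(Y₁)`: (5.4.1))
  let G' : Subgroup (G₂ × G₁) :=
    { carrier := {g | (ρ₂ g.1).hom ≫ ψ₂ = ψ₂ ≫ (ρY₁ g.2).hom}
      mul_mem' := fun {a b} ha hb => by
        simp only [Set.mem_setOf_eq, Prod.fst_mul, Prod.snd_mul, map_mul, Aut.Aut_mul_def,
          Iso.trans_hom, Category.assoc] at ha hb ⊢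
        rw [ha, reassoc_of% hb]
      one_mem' := by
        simp only [Set.mem_setOf_eq, Prod.fst_one, Prod.snd_one, map_one]
        show 𝟙 _ ≫ ψ₂ = ψ₂ ≫ 𝟙 _
        simp
      inv_mem' := fun {a} ha => by
        simp only [Set.mem_setOf_eq, Prod.fst_inv, Prod.snd_inv, map_inv, Aut.Aut_inv_def,
          Iso.symm_hom] at ha ⊢
        rw [Iso.inv_comp_eq, ← Category.assoc, ha, Category.assoc, Iso.hom_inv_id,
          Category.comp_id] }
  let pr₁ : G' →* G₂ := (MonoidHom.fst G₂ G₁).comp G'.subtype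
  let pr₂ : G' →* G₁ := (MonoidHom.snd G₂ G₁).comp G'.subtype
  -- the action of `G'` on `P = X₁ ×_{Y₁} Y₂`
  let θ : G' → (pullback f₁ ψ₂ ⟶ pullback f₁ ψ₂) := fun g =>
    pullback.map f₁ ψ₂ f₁ ψ₂ (ρX₁ g.1.2).hom (ρ₂ g.1.1).hom (ρY₁ g.1.2).hom (hf₁G g.1.2).symm
      (show (ρ₂ g.1.1).hom ≫ ψ₂ = ψ₂ ≫ (ρY₁ g.1.2).hom from g.2).symm
  have θfst : ∀ g, θ g ≫ pullback.fst f₁ ψ₂ = pullback.fst f₁ ψ₂ ≫ (ρX₁ g.1.2).hom :=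
    fun g => pullback.lift_fst _ _ _
  have θsnd : ∀ g, θ g ≫ pullback.snd f₁ ψ₂ = pullback.snd f₁ ψ₂ ≫ (ρ₂ g.1.1).hom :=
    fun g => pullback.lift_snd _ _ _
  have θone : θ 1 = 𝟙 _ := by
    apply pullback.hom_ext
    · rw [θfst, Category.id_comp]
      show _ ≫ (ρX₁ 1).hom = _
      rw [map_one]
      exact Category.comp_id _
    · rw [θsnd, Category.id_comp]
      show _ ≫ (ρ₂ 1).hom = _
      rw [map_one]
      exact Category.comp_id _
  have θmul : ∀ g h, θ (g * h) = θ h ≫ θ g := fun g h => by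
    apply pullback.hom_ext
    · rw [θfst, Category.assoc, θfst, reassoc_of% (θfst h)]
      show _ ≫ (ρX₁ (g.1.2 * h.1.2)).hom = _
      rw [map_mul, Aut.Aut_mul_def, Iso.trans_hom]
    · rw [θsnd, Category.assoc, θsnd, reassoc_of% (θsnd h)]
      show _ ≫ (ρ₂ (g.1.1 * h.1.1)).hom = _
      rw [map_mul, Aut.Aut_mul_def, Iso.trans_hom]
  let ρP : G' →* Aut (pullback f₁ ψ₂) :=
    { toFun := fun g => ⟨θ g, θ g⁻¹, by rw [← θmul, inv_mul_cancel, θone],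
        by rw [← θmul, mul_inv_cancel, θone]⟩
      map_one' := Iso.ext θone
      map_mul' := fun g h => Iso.ext (by rw [Aut.Aut_mul_def, Iso.trans_hom]; exact θmul g h) }
  have hρP : ∀ g, (ρP g).hom = θ g := fun g => rfl
  have hρP₁ : ∀ g, (ρP g).hom ≫ pullback.fst f₁ ψ₂ = pullback.fst f₁ ψ₂ ≫ (ρX₁ (pr₂ g)).hom :=
    fun g => θfst g
  have hρP₂ : ∀ g, (ρP g).hom ≫ pullback.snd f₁ ψ₂ = pullback.snd f₁ ψ₂ ≫ (ρ₂ (pr₁ g)).hom :=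
    fun g => θsnd g
  have hlift : Function.Surjective pr₂ := fun g₁ => by
    obtain ⟨g₂, rfl⟩ := hφ₂ g₁
    exact ⟨⟨(g₂, φ₂ g₂), hψ₂G g₂⟩, rfl⟩
  have hker : ∀ g₂ : G₂, (ρ₂ g₂).hom ≫ ψ₂ = ψ₂ → ∃ g : G', pr₁ g = g₂ ∧ pr₂ g = 1 := fun g₂ h =>
    ⟨⟨(g₂, 1), by
      show (ρ₂ g₂).hom ≫ ψ₂ = ψ₂ ≫ (ρY₁ 1).hom
      rw [map_one, h]
      exact (Category.comp_id _).symm⟩, rfl, rfl⟩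
  haveI : Finite G' := inferInstance
  refine ⟨G', inferInstance, inferInstance, pullback f₁ ψ₂, Y₂, inferInstance, inferInstance,
    pullback.snd f₁ ψ₂, ψ₂ ≫ q₁, ρP, ρ₂.comp pr₁, D₂, hD₂, m,
    DeJong1996.PreSemiStablePair.pullbackSection hσf ψ₂,
    isProjectiveOver_pullback_of_isSemiStableCurve hss₁ q₁ hprojX₁ ψ₂ hproj₂, hreg₂,
    fun g => hD₂stab (pr₁ g), fun g C hC hne => hD₂strict (pr₁ g) C hC hne, hss₁.baseChange ψ₂,
    hQS f₁ ψ₂ hss₁ hqs₁, smooth_pullback_snd_morphismRestrict hD₁ hsm₁ ψ₂ hD₂.isClosed hD₁D₂,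
    fun i => DeJong1996.PreSemiStablePair.pullbackSection_snd hσf ψ₂ i,
    pairwise_disjoint_pullbackSection hσf hσdisj ψ₂, exists_smooth_pullbackSection hσf hσsm ψ₂,
    fun g => hρP₂ g, fun g i => ?_, φ₁.comp pr₂, pullback.fst f₁ ψ₂ ≫ π₁, inferInstance,
    hφsurj.comp hlift, (isAlteration_pullback_fst_of_isSemiStableCurve hss₁ hψ₂alt).comp hπalt,
    ?_, fun g => ?_, ?_, fun x hx => ?_⟩
  · -- the sections are permuted
    obtain ⟨j, hj⟩ := hσG g.1.2 i
    exact ⟨j, pullbackSection_comp_eq hσf ψ₂ (hρP₁ g) (hρP₂ g) g.2 hj⟩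
  · -- `f₂ ≫ ψ₂ ≫ q₁ = (fst ≫ π₁) ≫ f`
    rw [Category.assoc, ← hπcomm, ← pullback.condition_assoc]
  · -- equivariance of `fst ≫ π₁`
    rw [← Category.assoc, hρP₁ g, Category.assoc, hπG (pr₂ g), Category.assoc]
    rfl
  · -- the purely inseparable clause (de Jong 1997, 5.4)
    exact galois_clause_pullback ρ f₁ ρX₁ ρY₁ π₁ hgal ρ₂ φ₂ ψ₂ hψ₂G hgal₂ (functionFieldMap_fieldRange_sup_eq_top f₁ ψ₂)
      pr₁ pr₂ ρP hρP₁ hρP₂ hlift hker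
  · -- the boundary
    exact preimage_fst_semiStableBoundary_subset hσf ψ₂ hD₁D₂ (hZbd hx)

end Summit.ResolutionOfSingularities.ResolutionOfSingularities.Theorems

end
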